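import Literature.NumberTheory.EllipticCurves.MazurTorsion
import Literature.NumberTheory.EllipticCurves.KubertTwoTwelve
import Literature.NumberTheory.EllipticCurves.KubertTateThirteen
import Literature.NumberTheory.EllipticCurves.IsogenyTwoTorsionProofs
import HarnessLib

/-!
# Kubert (1976), no `ℤ/2ℤ × ℤ/10ℤ` in `E(ℚ)`: reduction to the rational points of `X₁(2,10)`

Topic `NumberTheory/EllipticCurves`; sibling of `Literature.NumberTheory.EllipticCurves.MazurTorsion`,
whose named fact `Kubert1976_no_two_ten W` (D. S. Kubert, *Universal bounds on the torsion of
elliptic curves*, Proc. London Math. Soc. (3) 33 (1976) 193–237, Ch. IV: the modular curve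
`X₁(2,10)` has only cuspidal rational points; quoted by Mazur 1977, Ch. III §5, p. 156) says: for
an elliptic curve `E/ℚ` there is no injective homomorphism `ℤ/2ℤ × ℤ/10ℤ → E(ℚ)`. It is one of the
two Kubert leaves of the proved assembly `mazur_torsion_of_leaves`; the other one,
`Kubert1976_no_two_twelve`, is reduced in `KubertTwoTwelve.lean`, whose pattern this file follows.

This file REDUCES the fact, by a fully proved argument over any field of characteristic `0`, to a
statement about one explicit curve: every rational solution of `y² = x³ + x² - x` has
`x ∈ {0, 1, -1}` (`Kubert1976_no_two_ten_of_points`). That statement — the elliptic curve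
`y² = x³ + x² - x` (conductor `20`, a model of `X₁(2,10)`) has exactly the six rational points
`O, (0,0), (1,±1), (-1,±1)` — is PROVED in the sibling `KubertTwoTenProofs.lean` (descent via
`2`-isogeny, the tree's Mordell–Weil theorem, `p`-adic integrality of torsion), which then
discharges the fact (`Kubert1976_no_two_ten_holds`).

## The argument (all proved here; `KubertTwoTen.exists_param_of_injective`)

Let `g : ℤ/2ℤ × ℤ/10ℤ → E(F)` be injective, `char F = 0`.
1. `P = g(0,1)` has order `10`; as `2P, 3P ≠ 𝒪`, an admissible change of variables puts `E` in
   Tate normal form `E(b, c) : y² + (1-c)xy - by = x³ - bx²` with `P = (0, 0)` (Knapp §V.5; tree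
   `exists_variableChange_pointEquiv_eq_zero`, file `KubertTateNormalForm`).
2. `c ≠ 0` (else `3P = (0, b) = -P`) and `b ≠ c` (else `3P = (b, 0) = -2P`), so
   `b = rs(r-1)`, `c = s(r-1)` (Sutherland's coordinates, tree `exists_kubertTate_param`, file
   `KubertTateThirteen`) with `rs(r-1) ≠ 0`, and `5P = (rs(s-1), rs²(r-s))`
   (tree `kubertTate_five_nsmul_zero`).
3. `10P = 𝒪`, i.e. `5P = -5P`, reads `r(s² - 3s + 1) + s² = 0`: the raw equation of `X₁(10)`,
   Kubert's parametrisation `d = r = f²/(f - (f-1)²)`, `f = s` (Kubert 1976, Table 3; Sutherland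
   2012, Table). Hence `s² - 3s + 1 ≠ 0`, `s ∉ {0, 1/2, 1}`.
4. The full `2`-torsion is rational: `T₁ = 5P = g(0,5)`, `T₂ = g(1,0)`, `T₃ = g(1,5)` are three
   distinct affine `2`-torsion points, so the `2`-division cubic splits (tree
   `splitTwoTorsion_of_two_smul`, file `KubertTwoTwelve`): with `eᵢ = x(Tᵢ)`, `e₁ = rs(s-1)`,
   `b₂ = (1-c)² - 4b = -4(e₁+e₂+e₃)`, `b₄ = -(1-c)b = 2(e₁e₂+e₁e₃+e₂e₃)`. Then `σ = e₂ - e₃ ≠ 0`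
   and `16(e₂ - e₃)²`, a polynomial in `r, s`, becomes on `rq = -s²` (`q = s² - 3s + 1`)
   `σ² = (2s - 1)⁵(4s² - 2s - 1)/(16 q⁴)` — a plane model of the genus-`1` curve `X₁(2,10)` over
   the `s`-line `X₁(10)` (certified by `linear_combination`, certificate found by hand-rolled
   computer algebra and checked by the kernel).
5. Over `ℚ` (`exists_point_of_injective`): `x = 2s - 1`, `y = 4σq²/(2s-1)²` satisfy
   `y² = x³ + x² - x` with `x ∉ {0, 1, -1}` (as `s ∉ {1/2, 1, 0}`).

## References

* [Kubert1976] D. S. Kubert, *Universal bounds on the torsion of elliptic curves*, Proc. London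
  Math. Soc. (3) 33 (1976) 193–237, Ch. IV and Table 3. (The PDF held in the literature store
  under this paper's DOI is Kubert's 1979 *Compositio* sequel of the same title; the 1976 paper
  has been requested again; the statement reduced here is the one vendored in `MazurTorsion.lean`.)
* [Mazur1977] B. Mazur, *Modular curves and the Eisenstein ideal*, Publ. Math. IHÉS 47 (1977),
  Ch. III §5, p. 156 ("Kubert has shown ([27], chap. IV) …").
* [Knapp1993] A. W. Knapp, *Elliptic Curves*, Princeton 1992, §V.5 (Tate normal form).
* [Sutherland2012] A. V. Sutherland, *Constructing elliptic curves over finite fields with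
  prescribed torsion*, Math. Comp. 81 (2012), §2 (coordinates `r = b/c`, `s = c²/(b - c)`, the
  multiples `xₙ` of `(0,0)` and the raw equations of `X₁(N)`).

## Design

* The reduction is proved for a Weierstrass curve over any field `F` of characteristic `0` with
  `[DecidableEq F]` (the convention of `KubertTwoTwelve.lean`, so that at `F = ℚ` the group law is
  literally the one in `Kubert1976_no_two_ten`).
* No new definition and no named fact is introduced: the target statement about
  `y² = x³ + x² - x` is spelled out as the hypothesis of `Kubert1976_no_two_ten_of_points`.
-/

noncomputable section

/-! ### Affine points of `E(b, c)` on the `y`-axis -/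

namespace WeierstrassCurve

variable {F : Type*} [Field F] [DecidableEq F] (b c : F)

omit [DecidableEq F] in
/-- An affine point of `E(b, c)` with `x = 0` is `±(0, 0)`: its `y` satisfies `y² - by = 0`, and
`-(0, 0) = (0, b)` (Knapp, *Elliptic Curves*, §V.5 (5.30a)). [cite: Knapp1993, §V.5 (5.30a)] -/
theorem kubertTate_some_zero_eq {y : F} (h : (kubertTate b c).toAffine.Nonsingular 0 0)
    (hy : (kubertTate b c).toAffine.Nonsingular 0 y) :
    Affine.Point.some 0 y hy = Affine.Point.some 0 0 h ∨
      Affine.Point.some 0 y hy = -Affine.Point.some 0 0 h := by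
  have he := (Affine.equation_iff 0 y).mp hy.1
  simp only [kubertTate] at he
  have hy' : y * (y - b) = 0 := by linear_combination he
  rcases mul_eq_zero.mp hy' with h0 | h0
  · left; subst h0; rfl
  · right
    rw [kubertTate_neg_zero b c h]
    have : y = b := by linear_combination h0
    subst this; rfl

end WeierstrassCurve

/-! ### From `ℤ/2ℤ × ℤ/10ℤ ↪ E(F)` to Kubert's parameter and a point of `X₁(2,10)` -/

namespace Literature.NumberTheory.EllipticCurves.KubertTwoTen

open _root_.WeierstrassCurve _root_.WeierstrassCurve.Affine _root_.WeierstrassCurve.Affine.Point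
open Literature.NumberTheory.EllipticCurves.KubertTwoTwelve

section Generic

variable {F : Type*} [Field F] [DecidableEq F] [CharZero F]

/-- **From `ℤ/2ℤ × ℤ/10ℤ ↪ E(F)` to a point of `X₁(2,10)` (char. `0`).** If `E(F)` contains a
subgroup isomorphic to `ℤ/2ℤ × ℤ/10ℤ`, then there are `f, σ ∈ F` with `f ∉ {0, 1/2, 1}`,
`f² - 3f + 1 ≠ 0`, `σ ≠ 0` and `σ² = (2f - 1)⁵(4f² - 2f - 1)/(16(f² - 3f + 1)⁴)`. Proof: steps
1–4 of the module docstring — Tate normal form of `(E, g(0,1))`, Sutherland's coordinates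
`b = rs(r-1)`, `c = s(r-1)`, the relation `r(s²-3s+1) + s² = 0` from `5P = -5P`
(Kubert 1976, Table 3, `N = 10`: `d = f²/(f-(f-1)²)`, here `r = d`, `s = f`), and the splitting
of the `2`-division cubic by the three rational `2`-torsion points `5P, g(1,0), g(1,5)`, giving
`σ = x(g(1,0)) - x(g(1,5))`. [folklore] -/
theorem exists_param_of_injective {W : WeierstrassCurve F} (g : ZMod 2 × ZMod 10 →+ W.toAffine.Point)
    (hg : Function.Injective g) :
    ∃ f σ : F, f ≠ 0 ∧ f ≠ 1 ∧ 2 * f - 1 ≠ 0 ∧ f ^ 2 - 3 * f + 1 ≠ 0 ∧ σ ≠ 0 ∧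
      σ ^ 2 = (2 * f - 1) ^ 5 * (4 * f ^ 2 - 2 * f - 1) / (16 * (f ^ 2 - 3 * f + 1) ^ 4) := by
  have hne : ∀ {a : ZMod 2 × ZMod 10}, a ≠ 0 → g a ≠ 0 := fun ha h0 =>
    ha (hg (by rw [h0, g.map_zero]))
  -- the point of order `10` and its Tate normal form
  obtain ⟨x, y, hxy, hP⟩ := exists_eq_some_of_ne_zero (hne (a := (0, 1)) (by decide))
  have hmul : ∀ n : ℕ, n • (Point.some x y hxy : W.toAffine.Point) = g (0, (n : ZMod 10)) := by
    intro n
    rw [← hP, ← map_nsmul]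
    congr 1
    ext <;> simp
  have h₂ : 2 • (Point.some x y hxy : W.toAffine.Point) ≠ 0 := by
    rw [hmul]; exact hne (by decide)
  have h₃ : 3 • (Point.some x y hxy : W.toAffine.Point) ≠ 0 := by
    rw [hmul]; exact hne (by decide)
  obtain ⟨b, c, C, hC, h₀, he⟩ := exists_variableChange_pointEquiv_eq_zero W hxy h₂ h₃
  -- transport `g` to `E(b, c)`
  set ι : W.toAffine.Point ≃+ (kubertTate b c).toAffine.Point :=
    (VariableChange.pointEquiv W C).trans (Affine.Point.congrEquiv hC) with hι
  set g' : ZMod 2 × ZMod 10 →+ (kubertTate b c).toAffine.Point :=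
    ι.toAddMonoidHom.comp g with hg'def
  have hg' : Function.Injective g' := ι.injective.comp hg
  have hne' : ∀ {a : ZMod 2 × ZMod 10}, a ≠ 0 → g' a ≠ 0 := fun ha h0 =>
    ha (hg' (by rw [h0, g'.map_zero]))
  have hP₀ : g' (0, 1) = Point.some 0 0 h₀ := by
    show ι (g (0, 1)) = _
    rw [hP]; exact he
  have hmul' : ∀ n : ℕ, n • (Point.some 0 0 h₀ : (kubertTate b c).toAffine.Point) =
      g' (0, (n : ZMod 10)) := by
    intro n
    rw [← hP₀, ← map_nsmul]
    congr 1
    ext <;> simp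
  have hb : b ≠ 0 := (kubertTate_nonsingular_zero_iff b c).mp h₀
  -- equal multiples of `P = (0, 0)` have equal coefficients mod `10`
  have hinj : ∀ {m n : ℕ}, m • (Point.some 0 0 h₀ : (kubertTate b c).toAffine.Point) =
      n • Point.some 0 0 h₀ → ((m : ZMod 10)) = n := fun {m n} h => by
    rw [hmul', hmul'] at h
    simpa using congrArg Prod.snd (hg' h)
  -- `c ≠ 0`: otherwise `3P = (0, b) = ±P`
  have hc : c ≠ 0 := by
    intro hc0
    obtain ⟨h', e'⟩ := some_eq_some_of_eq (kubertTate_nonsingular_three b c hb) hc0 rfl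
    have e3 := kubertTate_three_nsmul_zero b c h₀
    rw [e'] at e3
    rcases kubertTate_some_zero_eq b c h₀ h' with e | e
    · exact absurd (hinj (m := 3) (n := 1) (by rw [e3, e, one_nsmul])) (by decide)
    · refine absurd (hinj (m := 4) (n := 0) ?_) (by decide)
      rw [show (4 : ℕ) = 3 + 1 from rfl, succ_nsmul, e3, e, zero_nsmul, neg_add_cancel]
  -- `b ≠ c`: otherwise `3P = (b, 0) = -2P`
  have hbc : b ≠ c := by
    intro hbc0
    refine absurd (hinj (m := 5) (n := 0) ?_) (by decide)
    have hneg : (3 • Point.some 0 0 h₀ : (kubertTate b c).toAffine.Point) =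
        -(2 • Point.some 0 0 h₀) := by
      rw [kubertTate_three_nsmul_zero b c h₀, kubertTate_two_nsmul_zero b c h₀,
        Affine.Point.neg_some]
      obtain ⟨h', e'⟩ := some_eq_some_of_eq (kubertTate_nonsingular_three b c hb) hbc0.symm
        (show b - c = (kubertTate b c).toAffine.negY b (b * c) by
          simp only [Affine.negY, kubertTate]; rw [hbc0]; ring)
      rw [e']
    rw [show (5 : ℕ) = 3 + 2 from rfl, add_nsmul, hneg, neg_add_cancel, zero_nsmul]
  -- Sutherland's coordinates `b = rs(r-1)`, `c = s(r-1)`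
  obtain ⟨r, s, hb', hc'⟩ := exists_kubertTate_param b c hc (sub_ne_zero.mpr hbc)
  subst hb' hc'
  have hs : s ≠ 0 := fun h0 => hc (by rw [h0, zero_mul])
  have hr₁ : r ≠ 1 := fun h1 => hc (by rw [h1, sub_self, mul_zero])
  have hr : r ≠ 0 := fun h0 => hb (by rw [h0]; ring)
  obtain ⟨h₅, e₅⟩ := kubertTate_five_nsmul_zero r s h₀ hr hr₁ hs
  -- `10P = 0`, i.e. `5P = -5P`: the raw equation `r(s² - 3s + 1) + s² = 0` of `X₁(10)`
  have h10 : (5 • Point.some 0 0 h₀ : (kubertTate (r * s * (r - 1)) (s * (r - 1))).toAffine.Point)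
      = -(5 • Point.some 0 0 h₀) := by
    apply eq_neg_of_add_eq_zero_left
    rw [← add_nsmul, hmul', show (((5 + 5 : ℕ) : ZMod 10)) = 0 from rfl]
    exact g'.map_zero
  rw [e₅, Affine.Point.neg_some, Affine.Point.some.injEq] at h10
  obtain ⟨-, hy⟩ := h10
  simp only [Affine.negY, kubertTate] at hy
  have hT : r * (s ^ 2 - 3 * s + 1) + s ^ 2 = 0 := by
    have h' : r * s * (r * (s ^ 2 - 3 * s + 1) + s ^ 2) = 0 := by linear_combination -hy
    rcases mul_eq_zero.mp h' with h'' | h''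
    · exact absurd h'' (mul_ne_zero hr hs)
    · exact h''
  have hq : s ^ 2 - 3 * s + 1 ≠ 0 := by
    intro h0
    have hs0 : s ^ 2 = 0 := by rw [← hT, h0]; ring
    have : s = 0 := pow_eq_zero_iff two_ne_zero |>.mp hs0
    exact hs this
  have hrq : r * (s ^ 2 - 3 * s + 1) = -s ^ 2 := by linear_combination hT
  have hr1q : (r - 1) * (s ^ 2 - 3 * s + 1) = -((2 * s - 1) * (s - 1)) := by
    linear_combination hT
  have hs₁ : s ≠ 1 := by
    rintro rfl
    apply hr₁
    norm_num at hr1q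
    linear_combination -hr1q
  have hs₂ : 2 * s - 1 ≠ 0 := by
    intro h0
    apply hr₁
    rw [h0, zero_mul, _root_.neg_zero, mul_eq_zero] at hr1q
    rcases hr1q with h | h
    · linear_combination h
    · exact absurd h hq
  -- the three rational `2`-torsion points
  have hT₁ : g' (0, 5) = Point.some (r * s * (s - 1)) (r * s ^ 2 * (r - s)) h₅ := by
    rw [← e₅, hmul']; rfl
  obtain ⟨e₂, w₂, h₂, hT₂⟩ := exists_eq_some_of_ne_zero (hne' (a := (1, 0)) (by decide))
  obtain ⟨e₃, w₃, h₃, hT₃⟩ := exists_eq_some_of_ne_zero (hne' (a := (1, 5)) (by decide))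
  have two : ∀ {a : ZMod 2 × ZMod 10}, (2 : ℤ) • a = 0 → (2 : ℤ) • g' a = 0 := fun ha => by
    rw [← map_zsmul, ha, g'.map_zero]
  have t₁ : (2 : ℤ) • (Point.some (r * s * (s - 1)) (r * s ^ 2 * (r - s)) h₅ :
      (kubertTate (r * s * (r - 1)) (s * (r - 1))).toAffine.Point) = 0 := hT₁ ▸ two (by decide)
  have t₂ : (2 : ℤ) • (Point.some e₂ w₂ h₂ :
      (kubertTate (r * s * (r - 1)) (s * (r - 1))).toAffine.Point) = 0 := hT₂ ▸ two (by decide)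
  have t₃ : (2 : ℤ) • (Point.some e₃ w₃ h₃ :
      (kubertTate (r * s * (r - 1)) (s * (r - 1))).toAffine.Point) = 0 := hT₃ ▸ two (by decide)
  have h₁₂ : (Point.some (r * s * (s - 1)) (r * s ^ 2 * (r - s)) h₅ :
      (kubertTate (r * s * (r - 1)) (s * (r - 1))).toAffine.Point) ≠ .some e₂ w₂ h₂ := by
    rw [← hT₁, ← hT₂]; exact fun h => absurd (hg' h) (by decide)
  have h₁₃ : (Point.some (r * s * (s - 1)) (r * s ^ 2 * (r - s)) h₅ :
      (kubertTate (r * s * (r - 1)) (s * (r - 1))).toAffine.Point) ≠ .some e₃ w₃ h₃ := by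
    rw [← hT₁, ← hT₃]; exact fun h => absurd (hg' h) (by decide)
  have h₂₃ : (Point.some e₂ w₂ h₂ :
      (kubertTate (r * s * (r - 1)) (s * (r - 1))).toAffine.Point) ≠ .some e₃ w₃ h₃ := by
    rw [← hT₂, ← hT₃]; exact fun h => absurd (hg' h) (by decide)
  have hsplit := splitTwoTorsion_of_two_smul t₁ t₂ t₃ h₁₂ h₁₃ h₂₃
  have he₂₃ : e₂ ≠ e₃ := X_ne_of_two_smul t₂ h₂₃
  -- symmetric functions of `e₂, e₃`
  have hb2 := hsplit.b₂_eq
  have hb4 := hsplit.b₄_eq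
  simp only [WeierstrassCurve.b₂, WeierstrassCurve.b₄, toAffine_a₁, toAffine_a₂, toAffine_a₃,
    toAffine_a₄, kubertTate_a₁, kubertTate_a₂, kubertTate_a₃, kubertTate_a₄] at hb2 hb4
  have hσ4 : 4 * (e₂ + e₃) = -((1 - s * (r - 1)) ^ 2 - 4 * (r * s * (r - 1)))
      - 4 * (r * s * (s - 1)) := by linear_combination hb2
  have hπ2 : 2 * (e₂ * e₃) = -((1 - s * (r - 1)) * (r * s * (r - 1)))
      - 2 * (r * s * (s - 1)) * (e₂ + e₃) := by linear_combination -hb4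
  have h16 : 16 * (e₂ - e₃) ^ 2 =
      (-((1 - s * (r - 1)) ^ 2 - 4 * (r * s * (r - 1))) - 4 * (r * s * (s - 1))) ^ 2
      + 32 * ((1 - s * (r - 1)) * (r * s * (r - 1)))
      + 16 * (r * s * (s - 1)) *
        (-((1 - s * (r - 1)) ^ 2 - 4 * (r * s * (r - 1))) - 4 * (r * s * (s - 1))) := by
    linear_combination (4 * (e₂ + e₃) + (-((1 - s * (r - 1)) ^ 2 - 4 * (r * s * (r - 1)))
      - 4 * (r * s * (s - 1))) + 16 * (r * s * (s - 1))) * hσ4 - 32 * hπ2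
  -- on `rq = -s²` this is `(2s-1)⁵(4s²-2s-1)/(16q⁴)`
  refine ⟨s, e₂ - e₃, hs, hs₁, hs₂, hq, sub_ne_zero.mpr he₂₃, ?_⟩
  rw [eq_div_iff (mul_ne_zero (by norm_num) (pow_ne_zero 4 hq))]
  linear_combination (s ^ 2 - 3 * s + 1) ^ 4 * h16 + (r ^ 3 * s ^ 10 - 17 * r ^ 3 * s ^ 9 + 118 * r ^ 3 * s ^ 8 - 429 * r ^ 3 * s ^ 7 + 870 * r
      ^ 3 * s ^ 6 - 969 * r ^ 3 * s ^ 5 + 553 * r ^ 3 * s ^ 4 - 152 * r ^ 3 * s ^ 3 + 16 * r ^ 3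
      * s ^ 2 - 13 * r ^ 2 * s ^ 10 + 182 * r ^ 2 * s ^ 9 - 1055 * r ^ 2 * s ^ 8 + 3250 * r ^ 2
      * s ^ 7 - 5685 * r ^ 2 * s ^ 6 + 5612 * r ^ 2 * s ^ 5 - 2968 * r ^ 2 * s ^ 4 + 780 * r ^ 2
      * s ^ 3 - 80 * r ^ 2 * s ^ 2 - 13 * r * s ^ 10 + 143 * r * s ^ 9 - 613 * r * s ^ 8 + 1288
      * r * s ^ 7 - 1408 * r * s ^ 6 + 984 * r * s ^ 5 - 834 * r * s ^ 4 + 574 * r * s ^ 3 - 194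
      * r * s ^ 2 + 24 * r * s + s ^ 10 - 8 * s ^ 9 + 16 * s ^ 8 + 20 * s ^ 7 - 80 * s ^ 6 - 136
      * s ^ 5 + 518 * s ^ 4 - 456 * s ^ 3 + 160 * s ^ 2 - 20 * s) * hrq

end Generic

/-! ### Over `ℚ`: a non-cuspidal rational point of `X₁(2,10) : y² = x³ + x² - x` -/

/-- **`ℤ/2ℤ × ℤ/10ℤ ↪ E(ℚ)` yields a rational point of `y² = x³ + x² - x` off its six obvious
points.** With Kubert's parameter `f` and `σ` from `exists_param_of_injective`, the point
`x = 2f - 1`, `y = 4σ(f² - 3f + 1)²/(2f - 1)²` satisfies `y² = x³ + x² - x`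
(`16 σ² (f²-3f+1)⁴/(2f-1)⁴ = (2f-1)(4f²-2f-1) = 8f³ - 8f² + 1`), and `x ∉ {0, 1, -1}` because
`f ∉ {1/2, 1, 0}`. [folklore] -/
theorem exists_point_of_injective {W : WeierstrassCurve ℚ} (g : ZMod 2 × ZMod 10 →+ W.toAffine.Point)
    (hg : Function.Injective g) :
    ∃ x y : ℚ, y ^ 2 = x ^ 3 + x ^ 2 - x ∧ x ≠ 0 ∧ x ≠ 1 ∧ x ≠ -1 := by
  obtain ⟨f, s, hf0, hf1, hf2, hq, -, hsq⟩ := exists_param_of_injective g hg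
  refine ⟨2 * f - 1, 4 * s * (f ^ 2 - 3 * f + 1) ^ 2 / (2 * f - 1) ^ 2, ?_, hf2, ?_, ?_⟩
  · rw [div_pow, div_eq_iff (pow_ne_zero 2 (pow_ne_zero 2 hf2))]
    have hsq' := (eq_div_iff (mul_ne_zero (by norm_num : (16 : ℚ) ≠ 0) (pow_ne_zero 4 hq))).mp hsq
    linear_combination hsq'
  · intro h; apply hf1; linear_combination h / 2
  · intro h; apply hf0; linear_combination h / 2

end Literature.NumberTheory.EllipticCurves.KubertTwoTen

/-! ### The reduction of Kubert's theorem to the rational points of `X₁(2,10)` -/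

namespace Literature.NumberTheory.EllipticCurves

open _root_.WeierstrassCurve

/-- **Kubert (1976), no `ℤ/2ℤ × ℤ/10ℤ`, from the rational points of `X₁(2,10)`.** If every
rational solution of `y² = x³ + x² - x` has `x ∈ {0, 1, -1}` (i.e. `X₁(2,10)(ℚ)` consists of its
six rational cusps; proved in `KubertTwoTenProofs`, theorem `X1TwoTen_points`), then no elliptic
curve over `ℚ` has a subgroup `ℤ/2ℤ × ℤ/10ℤ` in `E(ℚ)` (`Kubert1976_no_two_ten W`; Kubert 1976,
Ch. IV; Mazur 1977, Ch. III §5, p. 156): such a subgroup would give a rational point with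
`x ∉ {0, 1, -1}` (`KubertTwoTen.exists_point_of_injective`). [cite: Kubert1976, Ch. IV (X₁(2,10)); Mazur1977, Ch. III §5 p. 156] -/
theorem Kubert1976_no_two_ten_of_points
    (h : ∀ x y : ℚ, y ^ 2 = x ^ 3 + x ^ 2 - x → x = 0 ∨ x = 1 ∨ x = -1)
    (W : WeierstrassCurve ℚ) : Kubert1976_no_two_ten W := by
  intro _ hf
  obtain ⟨g, hg⟩ := hf
  obtain ⟨x, y, hxy, hx0, hx1, hx2⟩ := KubertTwoTen.exists_point_of_injective g hg
  rcases h x y hxy with e | e | e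
  exacts [hx0 e, hx1 e, hx2 e]

end Literature.NumberTheory.EllipticCurves

end
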